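import Mathlib.MeasureTheory.Integral.DominatedConvergence
import Literature.Barriers.AtomisticToContinuum.EnergyAsymptoticsWithoutCondensationEstimates

/-!
# Proof of `EnergyAsymptoticsWithoutCondensation` (LSSY (B.19): Bogoliubov's energy is exact to two orders for the δ-function gas)

Last of the sibling files (`…Poisson`, `…Comparison`, `…Estimates`, this one) proving the named
fact `Literature.Barriers.AtomisticToContinuum.EnergyAsymptoticsWithoutCondensation`, i.e.
`BoseGas.LiebLiniger.LiebLiniger_bogoliubovTwoOrders`: for every `ε > 0` there is `γ₀ > 0` such
that every continuous solution `f` of the Lieb–Liniger equations (B.14)–(B.15) on `[-K, K]` with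
`0 < γ = c/ρ < γ₀` has `|e - (γ - (4/3π)γ^{3/2})| ≤ ε γ^{3/2}`, `e = ρ⁻³∫ f k²`
[LSSY2005, App. B (B.19)].  The discharge `EnergyAsymptoticsWithoutCondensation_holds` is at the
end of the file.

The sibling file `EnergyAsymptoticsWithoutCondensationProofs.lean` (landed independently and in
parallel) contains another complete proof of the same named fact,
`LiebLiniger_bogoliubovTwoOrders_holds`, along closely related lines (Stieltjes transform of the
semicircle by an ODE in `κ` instead of residues; the same subsolution/duality mechanism).  The two
developments share no code; this file does not import that one.

## The proof

LSSY print (B.19) as the small-`γ` result of [LL] (Bogoliubov's method; the integral equation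
"solved on a computer"); the rigorous route recorded in the literature goes through Hutson's
uniform approximation of the solution of Love's equation and Gaudin's integration of it
[TracyWidom2016, §1.2].  The proof formalised here is different and elementary; it never
approximates the solution beyond a two-sided sandwich, and needs neither existence nor uniqueness:

1. Scale to `[-1,1]`: `g(q) = f(Kq)` solves `g = 1/(2π) + K_κ g`, `κ = c/K`; with `M₀ = ∫g`,
   `M₂ = ∫q²g` one has `e = M₂/M₀³`, `γ = κ/M₀` (file 2).
2. Closed forms (file 1): `K_κ[√(1-·²)] = B - κ` and `K_κ[(1-·²)^{3/2}] = DB - Dκ - 2k²κ²/B + 2k²κ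
   - κ/2`, where `w = kκ/B + iB` is the root of `w² = z² - 1`, `z = k + iκ`, `Im w > 0`
   (residues on the unit circle).
3. Sandwich (file 2): `√(1-k²)/(2πκ) ≤ g ≤ √(a²-k²)/(2πκ(1-θ))` by the comparison principle.
4. Duality (files 2–3): `⟨(I-K_κ)v, g⟩ = (1/2π)∫v` with `v = √(1-k²)` gives
   `m := 4κM₀ = 1 + 4∫ωg`, and with `v = (1-k²)^{3/2}` gives `∫(2k²-1)g = -1/(8κ) - ∫r₀g`.
5. Estimates (file 3): `∫ωg = O(κ log(1/κ) + √(ηκ))` and `∫ r₀(g - g₀) → 0` (choice `κ = t⁴`,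
   `η = t²`, `θ = t(1+t²)/2`), and here `∫ r₀ g₀ → 1/(3π)` by dominated convergence
   (`tendsto_integral_residual_mul_semicircle`; the pointwise limit is a derivative in `μ = κ²`,
   `hasDerivAt_bracket`).
6. Algebra (`energy_sub_bogoliubov_eq`): with `s = √m`,
   `e - e_B(γ) = -[4κ²(s²-1)² + 32κ³(∫r₀g - s³/(3π))]/s⁶`, `γ^{3/2} = 8κ³/s³`; the constant
   `-4/(3π)` of (B.19) is exactly what the limit `1/(3π)` of step 5 produces (`core_estimate`).
7. Small `γ` forces small `κ` since `g ≤ 1/(4 arctan(κ/2))` (`kappa_lt_of_gamma_lt`).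

## References

* [LSSY2005] E. H. Lieb, R. Seiringer, J. P. Solovej, J. Yngvason, *The Mathematics of the Bose
  Gas and its Condensation*, Birkhäuser 2005: App. B (B.14)–(B.19); Ch. 10 (paragraph after
  Thm. 10.1: "Bogoliubov's theory is asymptotically exact to the first two orders").
* [TracyWidom2016] C. A. Tracy, H. Widom, *On the ground state energy of the δ-function Bose
  gas*, J. Phys. A 49 (2016) 294001, §1.1–1.2 (Love form; Hutson–Gaudin route; `γ = 4κ²` at
  leading order).
-/

noncomputable section

open MeasureTheory Set Filter Real intervalIntegral Metric
open scoped Topology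

namespace Literature.Barriers.AtomisticToContinuum.BoseGas.LiebLiniger

/-! ### The limit `∫ r₀ g₀ → 1/(3π)` by dominated convergence -/

section Limit

/-- Derivative at `μ = 0` of the smooth function of `μ = κ²` behind the residual:
`G(μ) = B̃(μ)(A + μ) - 2k²μ/B̃(μ)`, `B̃(μ) = √((A + μ + √((A+μ)² + 4k²μ))/2)`, `A = 1 - k² > 0`;
`G'(0) = 3(1 - 2k²)/(2√A)`. [folklore] -/
lemma hasDerivAt_bracket {k : ℝ} (hA : 0 < 1 - k ^ 2) :
    HasDerivAt (fun μ : ℝ =>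
      √((1 - k ^ 2 + μ + √((1 - k ^ 2 + μ) ^ 2 + 4 * k ^ 2 * μ)) / 2) * (1 - k ^ 2 + μ)
        - 2 * k ^ 2 * μ / √((1 - k ^ 2 + μ + √((1 - k ^ 2 + μ) ^ 2 + 4 * k ^ 2 * μ)) / 2))
      (3 * (1 - 2 * k ^ 2) / (2 * √(1 - k ^ 2))) 0 := by
  set A := 1 - k ^ 2 with hA'
  set s := √A with hs'
  have hs : 0 < s := Real.sqrt_pos.2 hA
  have hs2 : s ^ 2 = A := Real.sq_sqrt hA.le
  have hid : HasDerivAt (fun μ : ℝ => μ) 1 0 := hasDerivAt_id 0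
  have hAμ : HasDerivAt (fun μ : ℝ => A + μ) 1 0 := hid.const_add A
  have hsq : HasDerivAt (fun μ : ℝ => (A + μ) ^ 2) (2 * A) 0 := by
    apply (hAμ.pow 2).congr_deriv
    simp
  have hlin4 : HasDerivAt (fun μ : ℝ => 4 * k ^ 2 * μ) (4 * k ^ 2) 0 := by
    simpa using hid.const_mul (4 * k ^ 2)
  have hlin2 : HasDerivAt (fun μ : ℝ => 2 * k ^ 2 * μ) (2 * k ^ 2) 0 := by
    simpa using hid.const_mul (2 * k ^ 2)
  have hS : HasDerivAt (fun μ : ℝ => (A + μ) ^ 2 + 4 * k ^ 2 * μ) (2 * A + 4 * k ^ 2) 0 :=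
    hsq.add hlin4
  have hS0 : (A + 0) ^ 2 + 4 * k ^ 2 * 0 = A ^ 2 := by ring
  have hsqrtS : HasDerivAt (fun μ : ℝ => √((A + μ) ^ 2 + 4 * k ^ 2 * μ))
      ((2 * A + 4 * k ^ 2) / (2 * A)) 0 := by
    apply (hS.sqrt (by rw [hS0]; positivity)).congr_deriv
    rw [hS0, Real.sqrt_sq hA.le]
  have hQ : HasDerivAt (fun μ : ℝ => (A + μ + √((A + μ) ^ 2 + 4 * k ^ 2 * μ)) / 2)
      ((1 + (2 * A + 4 * k ^ 2) / (2 * A)) / 2) 0 := (hAμ.add hsqrtS).div_const 2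
  have hQ0 : (A + 0 + √((A + 0) ^ 2 + 4 * k ^ 2 * 0)) / 2 = A := by
    rw [hS0, Real.sqrt_sq hA.le]; ring
  have hBt : HasDerivAt (fun μ : ℝ => √((A + μ + √((A + μ) ^ 2 + 4 * k ^ 2 * μ)) / 2))
      (((1 + (2 * A + 4 * k ^ 2) / (2 * A)) / 2) / (2 * s)) 0 := by
    apply (hQ.sqrt (by rw [hQ0]; exact hA.ne')).congr_deriv
    rw [hQ0]
  have hBt0 : √((A + 0 + √((A + 0) ^ 2 + 4 * k ^ 2 * 0)) / 2) = s := by rw [hQ0]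
  have hG := (hBt.mul hAμ).sub (hlin2.div hBt (by rw [hBt0]; exact hs.ne'))
  apply hG.congr_deriv
  rw [hBt0]
  simp only [add_zero, mul_zero, zero_mul, sub_zero, mul_one]
  have hk2 : k ^ 2 = 1 - s ^ 2 := by rw [hs2, hA']; ring
  rw [hA', hk2]
  have h1 : (1 : ℝ) - (1 - s ^ 2) = s ^ 2 := by ring
  rw [h1]
  field_simp
  ring

/-- `imRoot k κ` is `B̃(κ²)` with the `B̃` of `hasDerivAt_bracket`. [folklore] -/
lemma imRoot_eq_sqrt_sq (k κ : ℝ) : imRoot k κ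
    = √((1 - k ^ 2 + κ ^ 2 + √((1 - k ^ 2 + κ ^ 2) ^ 2 + 4 * k ^ 2 * κ ^ 2)) / 2) := by
  simp [imRoot, dRoot]

/-- Pointwise limit of the rescaled residual bracket: for `|k| < 1`,
`[B D - (1-k²)√(1-k²) - 2k²κ²/B]/κ² → 3(1-2k²)/(2√(1-k²))` as `κ → 0⁺`. [folklore] -/
lemma tendsto_bracket_div_sq {k : ℝ} (hA : 0 < 1 - k ^ 2) :
    Tendsto (fun κ : ℝ => (imRoot k κ * dRoot k κ - (1 - k ^ 2) * √(1 - k ^ 2)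
        - 2 * k ^ 2 * κ ^ 2 / imRoot k κ) / κ ^ 2)
      (𝓝[>] 0) (𝓝 (3 * (1 - 2 * k ^ 2) / (2 * √(1 - k ^ 2)))) := by
  have hG := hasDerivAt_bracket hA
  rw [hasDerivAt_iff_tendsto_slope] at hG
  have hsq : Tendsto (fun κ : ℝ => κ ^ 2) (𝓝[>] (0 : ℝ)) (𝓝[≠] 0) := by
    apply tendsto_nhdsWithin_of_tendsto_nhds_of_eventually_within
    · have : Tendsto (fun κ : ℝ => κ ^ 2) (𝓝 0) (𝓝 0) := by
        simpa using (continuous_pow 2).tendsto (0 : ℝ)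
      exact this.mono_left nhdsWithin_le_nhds
    · filter_upwards [self_mem_nhdsWithin] with κ hκ
      exact pow_ne_zero 2 (ne_of_gt hκ)
  have h := hG.comp hsq
  apply h.congr'
  filter_upwards [self_mem_nhdsWithin] with κ hκ
  simp only [Function.comp, slope_def_field, sub_zero, add_zero, mul_zero, zero_div,
    Real.sqrt_sq hA.le, add_self_div_two]
  rw [← imRoot_eq_sqrt_sq k κ]
  simp only [dRoot]
  ring

/-- `∫_{-1}^{1} (1 - 2k²)/(2π) dk = 1/(3π)`. [folklore] -/
lemma integral_limit_function : ∫ k in (-1 : ℝ)..1, (1 - 2 * k ^ 2) / (2 * π) = 1 / (3 * π) := by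
  have : ∀ k : ℝ, (1 - 2 * k ^ 2) / (2 * π) = (2 * π)⁻¹ * (1 - 2 * k ^ 2) := by intro k; ring
  simp_rw [this, intervalIntegral.integral_const_mul, integral_one_sub_two_mul_sq]
  field_simp

/-- **The constant `1/(3π)`.** `∫_{-1}^{1} r₀(k) √(1-k²)/(2πκ) dk → 1/(3π)` as `κ → 0⁺`
(dominated convergence: the integrand is bounded by `8/(3π)` for `κ ≤ 1` and tends pointwise to
`(1 - 2k²)/(2π)` for `|k| < 1`). [folklore] -/
theorem tendsto_integral_residual_mul_semicircle :
    Tendsto (fun κ : ℝ => ∫ k in (-1 : ℝ)..1, 2 / (3 * κ) * (imRoot k κ * dRoot k κ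
        - (1 - k ^ 2) * √(1 - k ^ 2) - 2 * k ^ 2 * κ ^ 2 / imRoot k κ - κ ^ 3)
        * (√(1 - k ^ 2) / (2 * π * κ)))
      (𝓝[>] 0) (𝓝 (1 / (3 * π))) := by
  have hπ := Real.pi_pos
  rw [← integral_limit_function]
  apply intervalIntegral.tendsto_integral_filter_of_dominated_convergence
    (bound := fun _ => 8 / (3 * π))
  · filter_upwards [self_mem_nhdsWithin] with κ hκ
    apply Continuous.aestronglyMeasurable
    exact (continuous_residual hκ).mul (by fun_prop)
  · filter_upwards [Ioc_mem_nhdsGT zero_lt_one] with κ hκ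
    have hκ0 : 0 < κ := hκ.1
    apply ae_of_all
    intro k hk
    rw [uIoc_of_le (by norm_num)] at hk
    have hk' : k ∈ Icc (-1 : ℝ) 1 := ⟨hk.1.le, hk.2⟩
    have hb := abs_bracket_mul_sqrt_le hκ.1 hκ.2 hk'
    rw [Real.norm_eq_abs]
    have e : 2 / (3 * κ) * (imRoot k κ * dRoot k κ - (1 - k ^ 2) * √(1 - k ^ 2)
          - 2 * k ^ 2 * κ ^ 2 / imRoot k κ - κ ^ 3) * (√(1 - k ^ 2) / (2 * π * κ))
        = ((imRoot k κ * dRoot k κ - (1 - k ^ 2) * √(1 - k ^ 2)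
          - 2 * k ^ 2 * κ ^ 2 / imRoot k κ - κ ^ 3) * √(1 - k ^ 2)) * (3 * π * κ ^ 2)⁻¹ := by
      field_simp
    rw [e, abs_mul, abs_inv, abs_of_pos (by positivity : 0 < 3 * π * κ ^ 2)]
    calc |(imRoot k κ * dRoot k κ - (1 - k ^ 2) * √(1 - k ^ 2) - 2 * k ^ 2 * κ ^ 2 / imRoot k κ
          - κ ^ 3) * √(1 - k ^ 2)| * (3 * π * κ ^ 2)⁻¹
        ≤ 8 * κ ^ 2 * (3 * π * κ ^ 2)⁻¹ := by gcongr
      _ = 8 / (3 * π) := by field_simp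
  · exact intervalIntegrable_const
  · have hae : ∀ᵐ k : ℝ, k ∉ ({1} : Set ℝ) :=
      (measure_eq_zero_iff_ae_notMem.1 (measure_singleton (1 : ℝ)))
    filter_upwards [hae] with k hk1 hk
    rw [uIoc_of_le (by norm_num)] at hk
    simp only [mem_singleton_iff] at hk1
    have hklt : k < 1 := lt_of_le_of_ne hk.2 hk1
    have hA : 0 < 1 - k ^ 2 := by nlinarith [hk.1]
    set A := 1 - k ^ 2 with hA'
    have hsA : 0 < √A := Real.sqrt_pos.2 hA
    have h1 := tendsto_bracket_div_sq hA
    have h2 : Tendsto (fun κ : ℝ => κ) (𝓝[>] (0 : ℝ)) (𝓝 0) :=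
      tendsto_id.mono_left nhdsWithin_le_nhds
    have h3 := ((h1.sub h2).mul_const (√A / (3 * π)))
    rw [sub_zero] at h3
    have e3 : 3 * (1 - 2 * k ^ 2) / (2 * √A) * (√A / (3 * π)) = (1 - 2 * k ^ 2) / (2 * π) := by
      field_simp
    rw [e3] at h3
    apply h3.congr'
    filter_upwards [self_mem_nhdsWithin] with κ hκ
    have hB := imRoot_pos k hκ
    have hκ0 : κ ≠ 0 := ne_of_gt hκ
    field_simp
    ring

end Limit



/-! ### Assembly -/

section Assembly

/-- `x^{3/2} = x √x` for `x ≥ 0`. [folklore] -/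
lemma rpow_three_halves {x : ℝ} (hx : 0 ≤ x) : x ^ (3 / 2 : ℝ) = x * √x := by
  rw [show (3 / 2 : ℝ) = 1 + 1 / 2 by norm_num, Real.rpow_add' hx (by norm_num), Real.rpow_one,
    Real.sqrt_eq_rpow]

/-- **Energy algebra.** With `m = s² = 4κM₀`, `M₂ = (M₀ - 1/(8κ) - R)/2` and `γ = κ/M₀ = 4κ²/s²`:
`e - e_B(γ) = -[4κ²(s²-1)² + 32κ³(R - s³/(3π))]/s⁶` and `γ^{3/2} = 8κ³/s³`. [folklore] -/
lemma energy_sub_bogoliubov_eq {κ s R : ℝ} (hκ : 0 < κ) (hs : 0 < s) :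
    ((s ^ 2 / (4 * κ) - 1 / (8 * κ) - R) / 2) / (s ^ 2 / (4 * κ)) ^ 3
        - bogoliubovEnergy (κ / (s ^ 2 / (4 * κ)))
      = -(4 * κ ^ 2 * (s ^ 2 - 1) ^ 2 + 32 * κ ^ 3 * (R - s ^ 3 / (3 * π))) / s ^ 6
    ∧ (κ / (s ^ 2 / (4 * κ))) ^ (3 / 2 : ℝ) = 8 * κ ^ 3 / s ^ 3 := by
  have hπ := Real.pi_pos
  have hγ : κ / (s ^ 2 / (4 * κ)) = (2 * κ / s) ^ 2 := by field_simp; ring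
  have h32 : (κ / (s ^ 2 / (4 * κ))) ^ (3 / 2 : ℝ) = 8 * κ ^ 3 / s ^ 3 := by
    rw [rpow_three_halves (by positivity), hγ, Real.sqrt_sq (by positivity)]
    field_simp
    ring
  refine ⟨?_, h32⟩
  unfold bogoliubovEnergy
  rw [h32, hγ]
  field_simp
  ring

/-- `s³ - 1 ≤ 3(s² - 1)` for `1 ≤ s` with `s² ≤ 2`. [folklore] -/
lemma cube_sub_one_le {s : ℝ} (hs : 1 ≤ s) (hs2 : s ^ 2 ≤ 2) : s ^ 3 - 1 ≤ 3 * (s ^ 2 - 1) := by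
  nlinarith

/-- `log((2+κ)/κ) ≤ 6/t` for `κ = t⁴`, `0 < t ≤ 1`. [folklore] -/
lemma log_le_of_eq_pow_four {t : ℝ} (ht : 0 < t) (ht1 : t ≤ 1) :
    Real.log ((2 + t ^ 4) / t ^ 4) ≤ 6 / t := by
  have ht4 : 0 < t ^ 4 := by positivity
  rw [Real.log_div (by positivity) ht4.ne', Real.log_pow]
  have h1 : Real.log (2 + t ^ 4) ≤ 2 := by
    have := Real.log_le_sub_one_of_pos (by positivity : (0:ℝ) < 2 + t ^ 4)
    nlinarith [pow_le_one₀ ht.le ht1 (n := 4)]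
  have h2 : -Real.log t ≤ 1 / t := by
    have := Real.log_le_sub_one_of_pos (by positivity : (0:ℝ) < t⁻¹)
    rw [Real.log_inv] at this
    have h3 : t⁻¹ - 1 ≤ 1 / t := by rw [one_div]; linarith
    linarith
  have h4 : (2 : ℝ) ≤ 2 / t := by
    rw [le_div_iff₀ ht]; nlinarith
  push_cast
  have h5 : 4 * (1 / t) = 4 / t := by ring
  calc Real.log (2 + t ^ 4) - 4 * Real.log t ≤ 2 + 4 * (1 / t) := by linarith
    _ ≤ 2 / t + 4 / t := by rw [h5]; linarith
    _ = 6 / t := by ring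

end Assembly

section Core

variable {κ : ℝ} {g : ℝ → ℝ}

/-- **Small `γ` forces small `κ`.** If `κ/∫g < 2κ₁ arctan(κ₁/2)` then `κ < κ₁`
(from `∫g ≤ 1/(2 arctan(κ/2))` and monotonicity). [folklore] -/
lemma kappa_lt_of_gamma_lt {κ₁ : ℝ} (hκ : 0 < κ) (hκ₁ : 0 < κ₁) (hg : ContinuousOn g (Icc (-1) 1))
    (hgeq : ∀ k ∈ Icc (-1 : ℝ) 1,
      g k = 1 / (2 * π) + π⁻¹ * ∫ p in (-1 : ℝ)..1, g p * poissonKernel κ k p)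
    (hγ : κ / (∫ k in (-1 : ℝ)..1, g k) < 2 * κ₁ * arctan (κ₁ / 2)) : κ < κ₁ := by
  by_contra h
  have h' : κ₁ ≤ κ := le_of_not_gt h
  have hM := integral_solution_le hκ hg hgeq
  have hM0 : 0 < ∫ k in (-1 : ℝ)..1, g k :=
    lt_of_lt_of_le (by positivity) (inv_four_mul_le_integral_solution hκ hg hgeq)
  have hat : 0 < arctan (κ / 2) := Real.arctan_pos.2 (by positivity)
  have hat₁ : 0 < arctan (κ₁ / 2) := Real.arctan_pos.2 (by positivity)
  have h1 : 2 * κ * arctan (κ / 2) ≤ κ / ∫ k in (-1 : ℝ)..1, g k := by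
    rw [le_div_iff₀ hM0]
    calc 2 * κ * arctan (κ / 2) * ∫ k in (-1 : ℝ)..1, g k
        ≤ 2 * κ * arctan (κ / 2) * (1 / (2 * arctan (κ / 2))) := by gcongr
      _ = κ := by field_simp
  have h2 : 2 * κ₁ * arctan (κ₁ / 2) ≤ 2 * κ * arctan (κ / 2) := by
    have : arctan (κ₁ / 2) ≤ arctan (κ / 2) := Real.arctan_strictMono.monotone (by linarith)
    gcongr
  linarith

/-- Splitting of the second moment: `∫ g k² = (∫ g + ∫ (2k²-1) g)/2`. [folklore] -/
lemma integral_mul_sq_eq (hg : ContinuousOn g (Icc (-1) 1)) :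
    ∫ k in (-1 : ℝ)..1, g k * k ^ 2
      = ((∫ k in (-1 : ℝ)..1, g k) + ∫ k in (-1 : ℝ)..1, (2 * k ^ 2 - 1) * g k) / 2 := by
  have h1 : IntervalIntegrable g volume (-1) 1 := hg.intervalIntegrable_of_Icc (by norm_num)
  have h2 : IntervalIntegrable (fun k => g k * k ^ 2) volume (-1) 1 := by
    apply ContinuousOn.intervalIntegrable_of_Icc (by norm_num)
    exact hg.mul (Continuous.continuousOn (by fun_prop))
  have e : ∀ k : ℝ, (2 * k ^ 2 - 1) * g k = 2 * (g k * k ^ 2) - g k := by intro k; ring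
  simp_rw [e]
  rw [intervalIntegral.integral_sub (h2.const_mul 2) h1, intervalIntegral.integral_const_mul]
  ring

/-- **Core estimate on `[-1, 1]`.** For every `ε > 0` there is `κ₁ > 0` such that every continuous
solution of the Love equation with `0 < κ < κ₁` satisfies
`|M₂/M₀³ - e_B(κ/M₀)| ≤ ε (κ/M₀)^{3/2}`, `M₀ = ∫g`, `M₂ = ∫ k² g`. [folklore] -/
theorem core_estimate {ε : ℝ} (hε : 0 < ε) : ∃ κ₁ > 0, ∀ κ : ℝ, 0 < κ → κ < κ₁ →
    ∀ g : ℝ → ℝ, ContinuousOn g (Icc (-1) 1) →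
    (∀ k ∈ Icc (-1 : ℝ) 1,
      g k = 1 / (2 * π) + π⁻¹ * ∫ p in (-1 : ℝ)..1, g p * poissonKernel κ k p) →
    |(∫ k in (-1 : ℝ)..1, g k * k ^ 2) / (∫ k in (-1 : ℝ)..1, g k) ^ 3
        - bogoliubovEnergy (κ / ∫ k in (-1 : ℝ)..1, g k)|
      ≤ ε * (κ / ∫ k in (-1 : ℝ)..1, g k) ^ (3 / 2 : ℝ) := by
  have hπ := Real.pi_pos
  have hπ3 := Real.pi_gt_three
  -- the non-explicit constant: dominated convergence
  have hD := tendsto_integral_residual_mul_semicircle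
  have hev := hD (Metric.ball_mem_nhds _ (by positivity : (0:ℝ) < ε / 16))
  rw [Filter.mem_map, mem_nhdsWithin_iff_exists_mem_nhds_inter] at hev
  obtain ⟨U, hU, hUsub⟩ := hev
  obtain ⟨κ₂, hκ₂, hball⟩ := Metric.mem_nhds_iff.1 hU
  -- the explicit constant
  set t₁ := min (1 / 100) (ε / 1000) with ht₁
  have ht₁0 : 0 < t₁ := by positivity
  refine ⟨min κ₂ (t₁ ^ 4), by positivity, ?_⟩
  intro κ hκ hκlt g hg hgeq
  have hκ2 : κ < κ₂ := lt_of_lt_of_le hκlt (min_le_left _ _)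
  have hκt : κ < t₁ ^ 4 := lt_of_lt_of_le hκlt (min_le_right _ _)
  have hR₀raw : |(∫ k in (-1 : ℝ)..1, 2 / (3 * κ) * (imRoot k κ * dRoot k κ
        - (1 - k ^ 2) * √(1 - k ^ 2) - 2 * k ^ 2 * κ ^ 2 / imRoot k κ - κ ^ 3)
        * (√(1 - k ^ 2) / (2 * π * κ))) - 1 / (3 * π)| < ε / 16 := by
    have hmem : κ ∈ U ∩ Ioi 0 := by
      refine ⟨hball ?_, hκ⟩
      simpa [abs_of_pos hκ] using hκ2
    have := hUsub hmem
    simpa [Real.dist_eq] using this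
  -- `t = κ^{1/4}`
  set t := √(√κ) with ht'
  have ht : 0 < t := by positivity
  have ht2 : t ^ 2 = √κ := Real.sq_sqrt (Real.sqrt_nonneg κ)
  have ht4 : t ^ 4 = κ := by rw [show t ^ 4 = (t ^ 2) ^ 2 by ring, ht2, Real.sq_sqrt hκ.le]
  have htt₁ : t < t₁ := by
    have : √(√κ) < √(√(t₁ ^ 4)) :=
      Real.sqrt_lt_sqrt (Real.sqrt_nonneg _) (Real.sqrt_lt_sqrt hκ.le hκt)
    rwa [show t₁ ^ 4 = (t₁ ^ 2) ^ 2 by ring, Real.sqrt_sq (by positivity),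
      Real.sqrt_sq ht₁0.le] at this
  have ht100 : t ≤ 1 / 100 := le_trans htt₁.le (min_le_left _ _)
  have htε : t ≤ ε / 1000 := le_trans htt₁.le (min_le_right _ _)
  have ht1 : t ≤ 1 := by linarith
  have ht2' : t ^ 2 ≤ t / 100 := by nlinarith only [ht, ht100]
  have ht3 : t ^ 3 ≤ t / 10000 := by nlinarith only [ht, ht2']
  -- `η = t²`, `θ = t(1+t²)/2`
  have hη1 : t ^ 2 ≤ 1 := pow_le_one₀ ht.le ht1
  have hκη : κ ≤ t ^ 2 := by
    rw [← ht4]; exact pow_le_pow_of_le_one ht.le ht1 (by norm_num : 2 ≤ 4)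
  have hsη : √(t ^ 2) = t := Real.sqrt_sq ht.le
  have hθeq : κ * (1 + t ^ 2) / (2 * t ^ 2 * √(t ^ 2)) = t * (1 + t ^ 2) / 2 := by
    rw [hsη, ← ht4]; field_simp
  have hθ : κ * (1 + t ^ 2) / (2 * t ^ 2 * √(t ^ 2)) ≤ 1 / 2 := by
    rw [hθeq]
    have : t * (1 + t ^ 2) ≤ 1 := by nlinarith only [ht, ht100, hη1]
    linarith
  have hlog0 : 0 ≤ Real.log ((2 + κ) / κ) :=
    Real.log_nonneg (by rw [le_div_iff₀ hκ]; linarith)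
  have hL := log_le_of_eq_pow_four ht ht1
  rw [ht4] at hL
  -- the pieces
  set M₀ := ∫ k in (-1 : ℝ)..1, g k with hM₀
  set W := ∫ k in (-1 : ℝ)..1, (imRoot k κ - √(1 - k ^ 2)) * g k with hW'
  set r : ℝ → ℝ := fun k => 2 / (3 * κ) * (imRoot k κ * dRoot k κ
    - (1 - k ^ 2) * √(1 - k ^ 2) - 2 * k ^ 2 * κ ^ 2 / imRoot k κ - κ ^ 3) with hr
  set R := ∫ k in (-1 : ℝ)..1, r k * g k with hR'
  set R₀ := ∫ k in (-1 : ℝ)..1, r k * (√(1 - k ^ 2) / (2 * π * κ)) with hR₀'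
  set R₁ := ∫ k in (-1 : ℝ)..1, r k * (g k - √(1 - k ^ 2) / (2 * π * κ)) with hR₁'
  have hM : κ * M₀ = 1 / 4 + W := kappa_mul_integral_eq hκ hg hgeq
  have hW0 : 0 ≤ W := by
    apply intervalIntegral.integral_nonneg (by norm_num)
    intro k hk
    exact mul_nonneg (imRoot_sub_sqrt_nonneg hκ) (solution_nonneg hκ hg hgeq k hk)
  have hWle : W ≤ 86 * t ^ 3 := by
    have h1 : W ≤ 8 / π * (κ * Real.log ((2 + κ) / κ) + 2 * √(t ^ 2) * √κ) :=
      integral_omega_mul_le hκ hκη hη1 hθ hg hgeq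
    rw [hsη, ← ht2] at h1
    have h2 : κ * Real.log ((2 + κ) / κ) ≤ 6 * t ^ 3 := by
      calc κ * Real.log ((2 + κ) / κ) ≤ κ * (6 / t) := by gcongr
        _ = 6 * t ^ 3 := by rw [← ht4]; field_simp
    have h3 : 8 / π ≤ 8 / 3 := div_le_div_of_nonneg_left (by norm_num) (by norm_num) hπ3.le
    have h4 : 0 ≤ κ * Real.log ((2 + κ) / κ) + 2 * t * t ^ 2 := by positivity
    calc W ≤ 8 / π * (κ * Real.log ((2 + κ) / κ) + 2 * t * t ^ 2) := h1
      _ ≤ 8 / 3 * (6 * t ^ 3 + 2 * t * t ^ 2) := by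
          apply mul_le_mul h3 (by linarith) h4 (by norm_num)
      _ = 64 / 3 * t ^ 3 := by ring
      _ ≤ 86 * t ^ 3 := by linarith [pow_pos ht 3]
  have hT : ∫ k in (-1 : ℝ)..1, (2 * k ^ 2 - 1) * g k = -1 / (8 * κ) - R := by
    rw [hR']; exact integral_chebyshev_mul_eq hκ hg hgeq
  have hR₁ : |R₁| ≤ 33 * t := by
    have h1 : |R₁| ≤ 8 / π * (t ^ 2 * Real.log ((2 + κ) / κ))
        + 96 / π * (κ * (1 + t ^ 2) / (2 * t ^ 2 * √(t ^ 2))) :=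
      abs_integral_residual_mul_sub_le hκ hκη hη1 hθ hg hgeq
    rw [hθeq] at h1
    have h2 : t ^ 2 * Real.log ((2 + κ) / κ) ≤ 6 * t := by
      calc t ^ 2 * Real.log ((2 + κ) / κ) ≤ t ^ 2 * (6 / t) := by gcongr
        _ = 6 * t := by field_simp
    have h83 : 8 / π ≤ 8 / 3 := div_le_div_of_nonneg_left (by norm_num) (by norm_num) hπ3.le
    have h96 : 96 / π ≤ 96 / 3 := div_le_div_of_nonneg_left (by norm_num) (by norm_num) hπ3.le
    have h3 : 8 / π * (t ^ 2 * Real.log ((2 + κ) / κ)) ≤ 8 / 3 * (6 * t) :=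
      mul_le_mul h83 h2 (by positivity) (by norm_num)
    have h4 : 96 / π * (t * (1 + t ^ 2) / 2) ≤ 96 / 3 * (t * (1 + t ^ 2) / 2) :=
      mul_le_mul_of_nonneg_right h96 (by positivity)
    calc |R₁| ≤ 8 / π * (t ^ 2 * Real.log ((2 + κ) / κ)) + 96 / π * (t * (1 + t ^ 2) / 2) := h1
      _ ≤ 8 / 3 * (6 * t) + 96 / 3 * (t * (1 + t ^ 2) / 2) := add_le_add h3 h4
      _ = 32 * t + 16 * t ^ 3 := by ring
      _ ≤ 33 * t := by linarith [ht3]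
  have hR₀ : |R₀ - 1 / (3 * π)| < ε / 16 := by rw [hR₀']; exact hR₀raw
  have hrg : IntervalIntegrable (fun k => r k * g k) volume (-1) 1 := by
    apply ContinuousOn.intervalIntegrable_of_Icc (by norm_num)
    exact (continuous_residual hκ).continuousOn.mul hg
  have hrg₀ : IntervalIntegrable (fun k => r k * (√(1 - k ^ 2) / (2 * π * κ))) volume (-1) 1 :=
    ((continuous_residual hκ).mul (by fun_prop)).intervalIntegrable _ _
  have hrg₁ : IntervalIntegrable (fun k => r k * (g k - √(1 - k ^ 2) / (2 * π * κ)))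
      volume (-1) 1 := by
    apply ContinuousOn.intervalIntegrable_of_Icc (by norm_num)
    exact (continuous_residual hκ).continuousOn.mul (hg.sub (Continuous.continuousOn (by fun_prop)))
  have hRsplit : R = R₀ + R₁ := by
    rw [hR₀', hR₁', ← intervalIntegral.integral_add hrg₀ hrg₁, hR']
    apply intervalIntegral.integral_congr
    intro k _
    simp only
    ring
  -- `m = s²`
  have hm1 : 1 ≤ 4 * κ * M₀ := by linarith
  set s := √(4 * κ * M₀) with hs'
  have hs0 : 0 < s := Real.sqrt_pos.2 (by linarith)
  have hs2 : s ^ 2 = 4 * κ * M₀ := Real.sq_sqrt (by linarith)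
  have hs1 : 1 ≤ s := (Real.le_sqrt zero_le_one (by linarith)).2 (by rw [one_pow]; exact hm1)
  have hM₀' : M₀ = s ^ 2 / (4 * κ) := by rw [hs2]; field_simp
  have hM₂ : ∫ k in (-1 : ℝ)..1, g k * k ^ 2 = (s ^ 2 / (4 * κ) - 1 / (8 * κ) - R) / 2 := by
    rw [integral_mul_sq_eq hg, hT, ← hM₀, hM₀']; ring
  obtain ⟨he, hγ32⟩ := energy_sub_bogoliubov_eq (R := R) hκ hs0
  rw [hM₂, hM₀', he, hγ32]
  -- numerics
  have hs21 : s ^ 2 - 1 ≤ 344 * t ^ 3 := by rw [hs2]; linarith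
  have hs21' : 0 ≤ s ^ 2 - 1 := by rw [hs2]; linarith
  have hs22 : s ^ 2 ≤ 2 := by linarith [hs21, ht3, ht100]
  have hs3 : s ^ 3 - 1 ≤ 3 * (s ^ 2 - 1) := cube_sub_one_le hs1 hs22
  have hRdev : |R - s ^ 3 / (3 * π)| ≤ ε / 16 + 33 * t + 344 * t ^ 3 := by
    have h1 : |R - 1 / (3 * π)| ≤ ε / 16 + 33 * t := by
      rw [hRsplit]
      calc |R₀ + R₁ - 1 / (3 * π)| = |(R₀ - 1 / (3 * π)) + R₁| := by ring_nf
        _ ≤ |R₀ - 1 / (3 * π)| + |R₁| := abs_add_le _ _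
        _ ≤ ε / 16 + 33 * t := by linarith
    have h2 : |1 / (3 * π) - s ^ 3 / (3 * π)| ≤ 344 * t ^ 3 := by
      have e : 1 / (3 * π) - s ^ 3 / (3 * π) = -((s ^ 3 - 1) / (3 * π)) := by ring
      have hs31 : 0 ≤ s ^ 3 - 1 := by linarith [one_le_pow₀ (n := 3) hs1]
      rw [e, abs_neg, abs_of_nonneg (div_nonneg hs31 (by positivity)),
        div_le_iff₀ (by positivity)]
      have : 1032 * t ^ 3 ≤ 344 * t ^ 3 * (3 * π) := by nlinarith only [pow_pos ht 3, hπ3]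
      linarith
    calc |R - s ^ 3 / (3 * π)| = |(R - 1 / (3 * π)) + (1 / (3 * π) - s ^ 3 / (3 * π))| := by
          ring_nf
      _ ≤ |R - 1 / (3 * π)| + |1 / (3 * π) - s ^ 3 / (3 * π)| := abs_add_le _ _
      _ ≤ ε / 16 + 33 * t + 344 * t ^ 3 := by linarith
  -- final inequality
  have hs6 : 0 < s ^ 6 := by positivity
  have hs3' : 1 ≤ s ^ 3 := one_le_pow₀ hs1
  rw [abs_div, abs_neg, abs_of_pos hs6, div_le_iff₀ hs6]
  have hnum : |4 * κ ^ 2 * (s ^ 2 - 1) ^ 2 + 32 * κ ^ 3 * (R - s ^ 3 / (3 * π))|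
      ≤ 4 * κ ^ 2 * (344 * t ^ 3) ^ 2 + 32 * κ ^ 3 * (ε / 16 + 33 * t + 344 * t ^ 3) := by
    calc |4 * κ ^ 2 * (s ^ 2 - 1) ^ 2 + 32 * κ ^ 3 * (R - s ^ 3 / (3 * π))|
        ≤ |4 * κ ^ 2 * (s ^ 2 - 1) ^ 2| + |32 * κ ^ 3 * (R - s ^ 3 / (3 * π))| := abs_add_le _ _
      _ = 4 * κ ^ 2 * (s ^ 2 - 1) ^ 2 + 32 * κ ^ 3 * |R - s ^ 3 / (3 * π)| := by
          rw [abs_of_nonneg (by positivity), abs_mul, abs_of_nonneg (by positivity)]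
      _ ≤ 4 * κ ^ 2 * (344 * t ^ 3) ^ 2 + 32 * κ ^ 3 * (ε / 16 + 33 * t + 344 * t ^ 3) := by
          gcongr
  have hpoly : 473344 * t ^ 2 + 1056 * t + 11008 * t ^ 3 ≤ 6 * ε := by
    linarith [ht2', ht3, htε]
  have hkey : 4 * κ ^ 2 * (344 * t ^ 3) ^ 2 + 32 * κ ^ 3 * (ε / 16 + 33 * t + 344 * t ^ 3)
      ≤ ε * (8 * κ ^ 3) := by
    rw [← ht4]
    have h12 := pow_pos ht 12
    calc 4 * (t ^ 4) ^ 2 * (344 * t ^ 3) ^ 2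
          + 32 * (t ^ 4) ^ 3 * (ε / 16 + 33 * t + 344 * t ^ 3)
        = t ^ 12 * (2 * ε + (473344 * t ^ 2 + 1056 * t + 11008 * t ^ 3)) := by ring
      _ ≤ t ^ 12 * (2 * ε + 6 * ε) := by gcongr
      _ = ε * (8 * (t ^ 4) ^ 3) := by ring
  calc |4 * κ ^ 2 * (s ^ 2 - 1) ^ 2 + 32 * κ ^ 3 * (R - s ^ 3 / (3 * π))|
      ≤ ε * (8 * κ ^ 3) := le_trans hnum hkey
    _ = ε * (8 * κ ^ 3 / s ^ 3) * s ^ 3 := by field_simp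
    _ ≤ ε * (8 * κ ^ 3 / s ^ 3) * s ^ 6 := by
        apply mul_le_mul_of_nonneg_left _ (by positivity)
        calc s ^ 3 = s ^ 3 * 1 := by ring
          _ ≤ s ^ 3 * s ^ 3 := by gcongr
          _ = s ^ 6 := by ring

end Core



/-! ### The named fact -/

end Literature.Barriers.AtomisticToContinuum.BoseGas.LiebLiniger

namespace Literature.Barriers.AtomisticToContinuum

open BoseGas.LiebLiniger

/-- **The catalogue entry `EnergyAsymptoticsWithoutCondensation`, discharged** (LSSY (B.19) to
two orders): for every `ε > 0` there is `γ₀ > 0` such that every continuous solution of the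
Lieb–Liniger equations (B.14)–(B.15) with `0 < γ = c/ρ < γ₀` satisfies
`|e - (γ - (4/3π)γ^{3/2})| ≤ ε γ^{3/2}`.  The entry is definitionally the named fact
`BoseGas.LiebLiniger.LiebLiniger_bogoliubovTwoOrders` (`energyAsymptoticsWithoutCondensation_iff`),
of which the sibling file `EnergyAsymptoticsWithoutCondensationProofs.lean` holds an independent
proof `LiebLiniger_bogoliubovTwoOrders_holds`; the proof below is the one of this file chain
(rescaling, `core_estimate`, `kappa_lt_of_gamma_lt`).
[cite: LSSY2005, App. B (B.19); Ch. 10 (paragraph after Thm. 10.1)] -/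
theorem EnergyAsymptoticsWithoutCondensation_holds : EnergyAsymptoticsWithoutCondensation := by
  unfold EnergyAsymptoticsWithoutCondensation LiebLiniger_bogoliubovTwoOrders
  intro ε hε
  obtain ⟨κ₁, hκ₁, hcore⟩ := core_estimate hε
  have hat : 0 < arctan (κ₁ / 2) := Real.arctan_pos.2 (by positivity)
  refine ⟨2 * κ₁ * arctan (κ₁ / 2), by positivity, ?_⟩
  intro c ρ K f hc hρ hγ hf
  have hK := hf.K_pos
  have hκ : 0 < c / K := div_pos hc hK
  have hg : ContinuousOn (fun q => f (K * q)) (Icc (-1) 1) := hf.continuousOn_rescale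
  have hgeq := hf.rescale_eq hc
  have hM₀ : ∫ q in (-1 : ℝ)..1, f (K * q) = ρ / K := hf.integral_rescale
  have hM₂ := hf.integral_rescale_sq
  have hγ' : c / ρ = (c / K) / ∫ q in (-1 : ℝ)..1, f (K * q) := by
    rw [hM₀]; field_simp
  have hκlt : c / K < κ₁ :=
    kappa_lt_of_gamma_lt hκ hκ₁ hg hgeq (by rw [← hγ']; exact hγ)
  have hmain := hcore (c / K) hκ hκlt (fun q => f (K * q)) hg hgeq
  have he : scaledEnergy ρ K f
      = (∫ q in (-1 : ℝ)..1, f (K * q) * q ^ 2) / (∫ q in (-1 : ℝ)..1, f (K * q)) ^ 3 := by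
    unfold scaledEnergy
    rw [hM₂, hM₀]
    field_simp
  rw [he, hγ']
  exact hmain

end Literature.Barriers.AtomisticToContinuum

end
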